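import Summits.CriticalPhenomena.PercolationContinuityZ3.Theorems.PercNearOneGluingNoHeavyLowerTailAPLSeriesParallel
import HarnessLib

/-!
# `NoHeavyLowerTail` (stmt-CriticalPhenomena-4575) — THE CLOSURE THRESHOLD: for every `C ≥ 28/27`, `E ≤ C` is preserved by PARALLEL composition
# (and by series composition, `series_reduction`, for `C ≥ 1`); for `C < 28/27` it is not (`sp_E_le_sharp`)

Support file (prover prim-ineq-gen-8 gen 61; `--supports stmt-CriticalPhenomena-4575`; memo
run/shared/lean/prim/prim-ineq-gen-8/FINDING-gen61-SPTHEOREM.md §1).  No definitions, no named facts, no sorries.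

The level-`C` versions of the gen-59/60 kernel (`shortcut_full_le`, `twoSided_of_transfer`, `twoSided_comp_le`, `parallel_comp_le`, all at `28/27`):
* `shortcut_full_le_C`, `shortcut_cells_le_C` — the apex-free shortcut preserves `E ≤ C` for every `C ≥ 28/27`; REDUCTION to `28/27`: rescale
  `m ↦ (27C/28)m` in `shortcut_full_le` (which needs no upper bound on `m`) and note `(C − 28/27)·w·(1−τ−A−B) ≥ 0`.
* `twoSided_of_transfer_C`, `twoSided_comp_le_C` — U(C): the two-sided composition theorem at level `C` (the gen-60 proof is `C`-free except
  through the shortcut: transfer inequality `κ_z ≤ O_yκ_{x′} + Q_xκ_{y′}`, `p_z ≥ √O_y p_{x′} + √O_x p_{y′}`, Cauchy–Schwarz).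
* (sequel `…APLLevelCParallel`: **`parallel_comp_le_C`**, the `PrW` form — for every `C ≥ 28/27`, `E ≤ C` on `D₁`, `D₂` glued at `o, u, v` ⇒ on `D₁ ∪ D₂`.)
CONSEQUENCE (with `series_reduction`, any `C ≥ 1`): for every `C ≥ 28/27` the class `{E ≤ C}` of `(o; u, v)`-networks is closed under all
series–parallel gluings, so for any family of PRIME pieces `𝒫` (not decomposable at a cut pair `{o, c}` or at the terminal triple `{o, u, v}`):
`sup E` over everything glued from `𝒫` is `max(28/27, sup_𝒫 E)` — the general conjectures (`C* ≈ 1.18`, (★★₂) `E ≤ 2`) are statements about prime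
pieces; and `28/27` is the least constant with this closure property (balanced ladders, `sp_E_le_sharp`). [this work]
-/

namespace Summit.CriticalPhenomena.PercolationContinuityZ3.Theorems

namespace APL

open Literature.Probability.Percolation Literature.Probability.Percolation.Gladkov Literature.Probability.Percolation.DecisionTree
open scoped Classical

variable {V : Type*} [Fintype V]

/-! ### The shortcut at every level `C ≥ 28/27` -/

/-- **The full-simplex shortcut theorem at every level `C ≥ 28/27`.**  Same setting as `shortcut_full_le`: cells `τ, A, B ≥ 0`, `p = τ + B > 0`,
`π = τ + A > 0`, Harris `pπ ≤ τ`; if `(τ − pπ)² ≤ C·pπ·m` then the shortcut of probability `w ∈ [0,1]` has `(τ′ − p′π′)² ≤ C·p′π′·m′`.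
Reduction to `C = 28/27`: apply `shortcut_full_le` to the rescaled `m₀ = (27C/28)·m` (no upper bound on `m` is needed there) and use
`(28/27)·(m₀ + w(1−τ−A−B−m₀)) ≤ C·(m + w(1−τ−A−B−m))`, i.e. `(C − 28/27)·w·(1−τ−A−B) ≥ 0` (Harris forces `τ+A+B ≤ 1`). [this work] -/
theorem shortcut_full_le_C (C : ℝ) (hC : 28 / 27 ≤ C) (τ A B m w : ℝ) (hτ : 0 ≤ τ) (hA : 0 ≤ A) (hB : 0 ≤ B)
    (hp : 0 < τ + B) (hπ : 0 < τ + A) (hH : (τ + B) * (τ + A) ≤ τ)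
    (hE : (τ - (τ + B) * (τ + A)) ^ 2 ≤ C * ((τ + B) * (τ + A)) * m) (hw0 : 0 ≤ w) (hw1 : w ≤ 1) :
    (τ + w * (A + B) - (τ + B + w * A) * (τ + A + w * B)) ^ 2
      ≤ C * ((τ + B + w * A) * (τ + A + w * B)) * (m + w * (1 - τ - A - B - m)) := by
  have hC0 : 0 < C := by linarith
  have hE0 : (τ - (τ + B) * (τ + A)) ^ 2 ≤ 28 / 27 * ((τ + B) * (τ + A)) * (27 * C / 28 * m) := by
    have e : 28 / 27 * ((τ + B) * (τ + A)) * (27 * C / 28 * m) = C * ((τ + B) * (τ + A)) * m := by ring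
    rw [e]; exact hE
  have h := shortcut_full_le τ A B (27 * C / 28 * m) w hτ hA hB hp hπ hH hE0 hw0 hw1
  have hτpos : 0 < τ := lt_of_lt_of_le (mul_pos hp hπ) hH
  have hsum : τ + A + B ≤ 1 := by
    have e : (τ + B) * (τ + A) = τ * (τ + A + B) + A * B := by ring
    have h1 : τ * (τ + A + B) ≤ τ * 1 := by linarith [mul_nonneg hA hB]
    exact le_of_mul_le_mul_left h1 hτpos
  have hP : 0 ≤ (τ + B + w * A) * (τ + A + w * B) := by
    have h1 : 0 ≤ τ + B + w * A := by nlinarith [mul_nonneg hw0 hA]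
    have h2 : 0 ≤ τ + A + w * B := by nlinarith [mul_nonneg hw0 hB]
    exact mul_nonneg h1 h2
  have hgap : 28 / 27 * (27 * C / 28 * m + w * (1 - τ - A - B - 27 * C / 28 * m)) ≤ C * (m + w * (1 - τ - A - B - m)) := by
    have h1 : 0 ≤ (C - 28 / 27) * (w * (1 - τ - A - B)) := mul_nonneg (by linarith) (mul_nonneg hw0 (by linarith))
    have e : C * (m + w * (1 - τ - A - B - m)) - 28 / 27 * (27 * C / 28 * m + w * (1 - τ - A - B - 27 * C / 28 * m))
        = (C - 28 / 27) * (w * (1 - τ - A - B)) := by ring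
    linarith
  calc (τ + w * (A + B) - (τ + B + w * A) * (τ + A + w * B)) ^ 2
      ≤ 28 / 27 * ((τ + B + w * A) * (τ + A + w * B)) * (27 * C / 28 * m + w * (1 - τ - A - B - 27 * C / 28 * m)) := h
    _ = ((τ + B + w * A) * (τ + A + w * B)) * (28 / 27 * (27 * C / 28 * m + w * (1 - τ - A - B - 27 * C / 28 * m))) := by ring
    _ ≤ ((τ + B + w * A) * (τ + A + w * B)) * (C * (m + w * (1 - τ - A - B - m))) := mul_le_mul_of_nonneg_left hgap hP
    _ = C * ((τ + B + w * A) * (τ + A + w * B)) * (m + w * (1 - τ - A - B - m)) := by ring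

/-- **`shortcut_cells_le` at every level `C ≥ 28/27`** (the five cells `(x₀, B, A, m, τ)` of `(o; u, v)`, sum `1`, including the degenerate
cases `p = 0` / `π = 0`). [this work] -/
theorem shortcut_cells_le_C (C : ℝ) (hC : 28 / 27 ≤ C) (x0 B A m τ w : ℝ) (h0 : 0 ≤ x0) (hB : 0 ≤ B) (hA : 0 ≤ A) (hm : 0 ≤ m) (hτ : 0 ≤ τ)
    (hsum : x0 + B + A + m + τ = 1) (hH : (τ + B) * (τ + A) ≤ τ)
    (hE : (τ - (τ + B) * (τ + A)) ^ 2 ≤ C * ((τ + B) * (τ + A)) * m) (hw0 : 0 ≤ w) (hw1 : w ≤ 1) :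
    (τ + w * (A + B) - (τ + B + w * A) * (τ + A + w * B)) ^ 2
      ≤ C * ((τ + B + w * A) * (τ + A + w * B)) * (m + w * x0) := by
  have hC1 : 1 ≤ C := by linarith
  have hx0 : x0 = 1 - τ - A - B - m := by linarith
  rcases (add_nonneg hτ hB).eq_or_lt with hp | hp
  · -- p = τ + B = 0: τ = B = 0
    have hτ0 : τ = 0 := by linarith
    have hB0 : B = 0 := by linarith
    subst hτ0; subst hB0
    have hA1 : A ≤ 1 := by linarith
    have h1 : w * (1 - A) ^ 2 ≤ 1 * (m + w * x0) := by nlinarith [mul_nonneg hw0 hA, mul_nonneg hm (sub_nonneg.2 hw1)]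
    have h2 : 1 * (m + w * x0) ≤ C * (m + w * x0) := mul_le_mul_of_nonneg_right hC1 (by positivity)
    nlinarith [mul_nonneg (mul_nonneg hw0 (sq_nonneg A)) (sub_nonneg.2 (h1.trans h2))]
  rcases (add_nonneg hτ hA).eq_or_lt with hπ | hπ
  · -- π = τ + A = 0
    have hτ0 : τ = 0 := by linarith
    have hA0 : A = 0 := by linarith
    subst hτ0; subst hA0
    have hB1 : B ≤ 1 := by linarith
    have h1 : w * (1 - B) ^ 2 ≤ 1 * (m + w * x0) := by nlinarith [mul_nonneg hw0 hB, mul_nonneg hm (sub_nonneg.2 hw1)]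
    have h2 : 1 * (m + w * x0) ≤ C * (m + w * x0) := mul_le_mul_of_nonneg_right hC1 (by positivity)
    nlinarith [mul_nonneg (mul_nonneg hw0 (sq_nonneg B)) (sub_nonneg.2 (h1.trans h2))]
  rw [hx0]
  exact shortcut_full_le_C C hC τ A B m w hτ hA hB hp hπ hH hE hw0 hw1

/-! ### U(C): the two-sided composition theorem at every level `C ≥ 28/27` -/

/-- **Transfer + Cauchy–Schwarz at level `C`** (`twoSided_of_transfer` with `28/27 ↦ C ≥ 28/27`): for valid pieces `x, y` with Harris at the
apex and `E ≤ C`, the inequality (b′) `(√P₁ + √P₂)² ≤ p_zπ_z` for the pair implies `E(x ⊙ y) ≤ C`. [this work] -/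
theorem twoSided_of_transfer_C (C : ℝ) (hC : 28 / 27 ≤ C) (x0 B A m τ y0 B' A' m' τ' zB zA zm zτ P₁ P₂ : ℝ)
    (h0 : 0 ≤ x0) (hB : 0 ≤ B) (hA : 0 ≤ A) (hm : 0 ≤ m) (hτ : 0 ≤ τ) (hsum : x0 + B + A + m + τ = 1)
    (h0' : 0 ≤ y0) (hB' : 0 ≤ B') (hA' : 0 ≤ A') (hm' : 0 ≤ m') (hτ' : 0 ≤ τ') (hsum' : y0 + B' + A' + m' + τ' = 1)
    (hOx : 0 < x0 + m) (hOy : 0 < y0 + m')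
    (hH : (τ + B) * (τ + A) ≤ τ) (hE : (τ - (τ + B) * (τ + A)) ^ 2 ≤ C * ((τ + B) * (τ + A)) * m)
    (hH' : (τ' + B') * (τ' + A') ≤ τ') (hE' : (τ' - (τ' + B') * (τ' + A')) ^ 2 ≤ C * ((τ' + B') * (τ' + A')) * m')
    (hzB : zB = x0 * B' + B * y0 + B * B') (hzA : zA = x0 * A' + A * y0 + A * A') (hzm : zm = x0 * m' + m * y0 + m * m')
    (hzτ : zτ = τ * (y0 + B' + A' + m' + τ') + (x0 + B + A + m) * τ' + B * (A' + m') + A * (B' + m') + m * (B' + A'))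
    (hP₁ : P₁ = (y0 + m') * ((τ + B + m' / (y0 + m') * A) * (τ + A + m' / (y0 + m') * B)))
    (hP₂ : P₂ = ((x0 + m + A) * (x0 + m + B)) ^ 2 * ((τ' + B' + m / (x0 + m) * A') * (τ' + A' + m / (x0 + m) * B')) / (x0 + m))
    (hb : (Real.sqrt P₁ + Real.sqrt P₂) ^ 2 ≤ (zτ + zB) * (zτ + zA)) :
    (zτ - (zτ + zB) * (zτ + zA)) ^ 2 ≤ C * ((zτ + zB) * (zτ + zA)) * zm := by
  have hC0 : (0 : ℝ) ≤ C := by linarith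
  obtain ⟨w, hw⟩ : ∃ t : ℝ, t = m' / (y0 + m') := ⟨_, rfl⟩
  obtain ⟨v, hv⟩ : ∃ t : ℝ, t = m / (x0 + m) := ⟨_, rfl⟩
  have hw0 : 0 ≤ w := by rw [hw]; positivity
  have hw1 : w ≤ 1 := by rw [hw, div_le_one hOy]; linarith
  have hv0 : 0 ≤ v := by rw [hv]; positivity
  have hv1 : v ≤ 1 := by rw [hv, div_le_one hOx]; linarith
  have hwO : (y0 + m') * w = m' := by rw [hw]; field_simp
  have hvO : (x0 + m) * v = m := by rw [hv]; field_simp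
  -- the two one-sided shortcuts
  have h1 := shortcut_cells_le_C C hC x0 B A m τ w h0 hB hA hm hτ hsum hH hE hw0 hw1
  have h2 := shortcut_cells_le_C C hC y0 B' A' m' τ' v h0' hB' hA' hm' hτ' hsum' hH' hE' hv0 hv1
  obtain ⟨κ₁, hκ₁⟩ : ∃ t : ℝ, t = τ + w * (A + B) - (τ + B + w * A) * (τ + A + w * B) := ⟨_, rfl⟩
  obtain ⟨κ₂, hκ₂⟩ : ∃ t : ℝ, t = τ' + v * (A' + B') - (τ' + B' + v * A') * (τ' + A' + v * B') := ⟨_, rfl⟩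
  rw [← hκ₁] at h1; rw [← hκ₂] at h2
  -- Harris of the shortcuts
  have hx0 : x0 = 1 - B - A - m - τ := by linarith
  have hy0 : y0 = 1 - B' - A' - m' - τ' := by linarith
  have hκ₁0 : 0 ≤ κ₁ := by
    have e : κ₁ = (τ - (τ + B) * (τ + A)) + w * (A + B) * (x0 + m) + w * A * B * (2 - w) := by rw [hκ₁, hx0]; ring
    have : 0 ≤ w * (A + B) * (x0 + m) + w * A * B * (2 - w) := by
      have : 0 ≤ 2 - w := by linarith
      positivity
    linarith [sub_nonneg.2 hH]
  have hκ₂0 : 0 ≤ κ₂ := by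
    have e : κ₂ = (τ' - (τ' + B') * (τ' + A')) + v * (A' + B') * (y0 + m') + v * A' * B' * (2 - v) := by rw [hκ₂, hy0]; ring
    have : 0 ≤ v * (A' + B') * (y0 + m') + v * A' * B' * (2 - v) := by
      have : 0 ≤ 2 - v := by linarith
      positivity
    linarith [sub_nonneg.2 hH']
  -- the composite covariance and Harris of the composite
  obtain ⟨κz, hκz⟩ : ∃ t : ℝ, t = zτ - (zτ + zB) * (zτ + zA) := ⟨_, rfl⟩
  have eκz : (x0 * y0 + (x0 * m' + m * y0 + m * m'))
        * (τ * (y0 + B' + A' + m' + τ') + (x0 + B + A + m) * τ' + B * (A' + m') + A * (B' + m') + m * (B' + A'))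
      - (x0 * A' + A * y0 + A * A') * (x0 * B' + B * y0 + B * B') = κz := by
    rw [hκz, hzτ, hzB, hzA, hx0, hy0]; ring
  have hκz0 : 0 ≤ κz := by
    rw [← eκz]
    exact comp_harris x0 B A m τ y0 B' A' m' τ' h0 hB hA hm hτ h0' hB' hA' hm' hτ'
      (by have e : (x0 + m) * τ - A * B = τ - (τ + B) * (τ + A) := by rw [hx0]; ring
          rw [e]; linarith [hH])
      (by have e : (y0 + m') * τ' - A' * B' = τ' - (τ' + B') * (τ' + A') := by rw [hy0]; ring
          rw [e]; linarith [hH'])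
  -- the transfer inequality: O_y O_x² κ_z ≤ O_x² (O_y² κ₁) + O_y Q_x (O_x² κ₂)
  have ht := transfer_kappa_le x0 B A m τ y0 B' A' m' τ' h0 hB hA hm h0' hB' hA' hm' hτ' hsum hsum'
  have e1 : (y0 + m') ^ 2 * (x0 + m) * τ + (y0 + m') * m' * (x0 + m) * (A + B) - y0 ^ 2 * A * B = (y0 + m') ^ 2 * κ₁ := by
    rw [hκ₁, hx0]
    linear_combination (-(y0 + m') * ((1 - B - A - m - τ) + m) * (A + B) - 2 * y0 * A * B + ((y0 + m') * w - m') * A * B) * hwO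
  have e2 : (x0 + m) ^ 2 * (y0 + m') * τ' + (x0 + m) * m * (y0 + m') * (A' + B') - x0 ^ 2 * A' * B' = (x0 + m) ^ 2 * κ₂ := by
    rw [hκ₂, hy0]
    linear_combination (-(x0 + m) * ((1 - B' - A' - m' - τ') + m') * (A' + B') - 2 * x0 * A' * B' + ((x0 + m) * v - m) * A' * B') * hvO
  rw [e1, e2, eκz] at ht
  -- divide by O_y O_x² > 0 :  κ_z ≤ O_y κ₁ + Q_x κ₂
  obtain ⟨Q, hQ⟩ : ∃ t : ℝ, t = (x0 + m + A) * (x0 + m + B) := ⟨_, rfl⟩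
  rw [← hQ] at ht
  have hQ0 : 0 ≤ Q := by rw [hQ]; positivity
  have hpos : 0 < (y0 + m') * (x0 + m) ^ 2 := by positivity
  have ha : κz ≤ (y0 + m') * κ₁ + Q * κ₂ := by
    have : (y0 + m') * (x0 + m) ^ 2 * κz ≤ (y0 + m') * (x0 + m) ^ 2 * ((y0 + m') * κ₁ + Q * κ₂) := by
      calc (y0 + m') * (x0 + m) ^ 2 * κz ≤ (x0 + m) ^ 2 * ((y0 + m') ^ 2 * κ₁) + (y0 + m') * Q * ((x0 + m) ^ 2 * κ₂) := ht
        _ = (y0 + m') * (x0 + m) ^ 2 * ((y0 + m') * κ₁ + Q * κ₂) := by ring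
    exact le_of_mul_le_mul_left this hpos
  -- the m identities: O_y m_{x′} = z_m = O_x m_{y′}
  have em1 : (y0 + m') * (m + w * x0) = zm := by
    rw [hzm]; linear_combination x0 * hwO
  have em2 : (x0 + m) * (m' + v * y0) = zm := by
    rw [hzm]; linear_combination y0 * hvO
  -- X := O_y κ₁, Y := Q κ₂ :  X² ≤ C z_m P₁,  Y² ≤ C z_m P₂
  have hzm0 : 0 ≤ zm := by rw [hzm]; positivity
  have hP₁0 : 0 ≤ P₁ := by rw [hP₁]; rw [← hw]; positivity
  have hP₂0 : 0 ≤ P₂ := by rw [hP₂]; rw [← hv]; positivity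
  have hX2 : ((y0 + m') * κ₁) ^ 2 ≤ C * zm * P₁ := by
    have h1' : κ₁ ^ 2 ≤ C * ((τ + B + w * A) * (τ + A + w * B)) * (m + w * x0) := h1
    have := mul_le_mul_of_nonneg_left h1' (sq_nonneg (y0 + m'))
    calc ((y0 + m') * κ₁) ^ 2 = (y0 + m') ^ 2 * κ₁ ^ 2 := by ring
      _ ≤ (y0 + m') ^ 2 * (C * ((τ + B + w * A) * (τ + A + w * B)) * (m + w * x0)) := this
      _ = C * ((y0 + m') * (m + w * x0)) * ((y0 + m') * ((τ + B + w * A) * (τ + A + w * B))) := by ring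
      _ = C * zm * P₁ := by rw [em1, hP₁, ← hw]
  have hY2 : (Q * κ₂) ^ 2 ≤ C * zm * P₂ := by
    have h2' : κ₂ ^ 2 ≤ C * ((τ' + B' + v * A') * (τ' + A' + v * B')) * (m' + v * y0) := h2
    have := mul_le_mul_of_nonneg_left h2' (sq_nonneg Q)
    have eP₂ : P₂ = Q ^ 2 * ((τ' + B' + v * A') * (τ' + A' + v * B')) / (x0 + m) := by rw [hP₂, hQ, ← hv]
    calc (Q * κ₂) ^ 2 = Q ^ 2 * κ₂ ^ 2 := by ring
      _ ≤ Q ^ 2 * (C * ((τ' + B' + v * A') * (τ' + A' + v * B')) * (m' + v * y0)) := this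
      _ = C * ((x0 + m) * (m' + v * y0)) * (Q ^ 2 * ((τ' + B' + v * A') * (τ' + A' + v * B')) / (x0 + m)) := by
          field_simp
      _ = C * zm * P₂ := by rw [em2, eP₂]
  -- Cauchy–Schwarz assembly
  have hX0 : 0 ≤ (y0 + m') * κ₁ := by positivity
  have hY0 : 0 ≤ Q * κ₂ := by positivity
  have hc0 : 0 ≤ C * zm := mul_nonneg hC0 hzm0
  have hXle : (y0 + m') * κ₁ ≤ Real.sqrt (C * zm) * Real.sqrt P₁ := by
    rw [← Real.sqrt_mul hc0, ← Real.sqrt_sq hX0]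
    exact Real.sqrt_le_sqrt (by linarith [hX2])
  have hYle : Q * κ₂ ≤ Real.sqrt (C * zm) * Real.sqrt P₂ := by
    rw [← Real.sqrt_mul hc0, ← Real.sqrt_sq hY0]
    exact Real.sqrt_le_sqrt (by linarith [hY2])
  have hsum_le : κz ≤ Real.sqrt (C * zm) * (Real.sqrt P₁ + Real.sqrt P₂) := by
    calc κz ≤ (y0 + m') * κ₁ + Q * κ₂ := ha
      _ ≤ Real.sqrt (C * zm) * Real.sqrt P₁ + Real.sqrt (C * zm) * Real.sqrt P₂ := add_le_add hXle hYle
      _ = Real.sqrt (C * zm) * (Real.sqrt P₁ + Real.sqrt P₂) := by ring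
  have hS0 : 0 ≤ Real.sqrt (C * zm) * (Real.sqrt P₁ + Real.sqrt P₂) := by positivity
  have hsq : κz ^ 2 ≤ (Real.sqrt (C * zm) * (Real.sqrt P₁ + Real.sqrt P₂)) ^ 2 := pow_le_pow_left₀ hκz0 hsum_le 2
  rw [← hκz]
  calc κz ^ 2 ≤ (Real.sqrt (C * zm) * (Real.sqrt P₁ + Real.sqrt P₂)) ^ 2 := hsq
    _ = (Real.sqrt (C * zm)) ^ 2 * (Real.sqrt P₁ + Real.sqrt P₂) ^ 2 := by ring
    _ = C * zm * (Real.sqrt P₁ + Real.sqrt P₂) ^ 2 := by rw [Real.sq_sqrt hc0]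
    _ ≤ C * zm * ((zτ + zB) * (zτ + zA)) := mul_le_mul_of_nonneg_left hb hc0
    _ = C * ((zτ + zB) * (zτ + zA)) * zm := by ring

/-- `(√(a₁b₁) + √(a₂b₂))² ≤ (a₁+a₂)(b₁+b₂)` (Cauchy–Schwarz for two terms). [folklore] -/
private theorem cs_two_C (a₁ a₂ b₁ b₂ : ℝ) (ha₁ : 0 ≤ a₁) (ha₂ : 0 ≤ a₂) (hb₁ : 0 ≤ b₁) (hb₂ : 0 ≤ b₂) :
    (Real.sqrt (a₁ * b₁) + Real.sqrt (a₂ * b₂)) ^ 2 ≤ (a₁ + a₂) * (b₁ + b₂) := by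
  have h1 : Real.sqrt (a₁ * b₁) ^ 2 = a₁ * b₁ := Real.sq_sqrt (by positivity)
  have h2 : Real.sqrt (a₂ * b₂) ^ 2 = a₂ * b₂ := Real.sq_sqrt (by positivity)
  have h3 : 2 * (Real.sqrt (a₁ * b₁) * Real.sqrt (a₂ * b₂)) ≤ a₁ * b₂ + a₂ * b₁ := by
    have e : Real.sqrt (a₁ * b₁) * Real.sqrt (a₂ * b₂) = Real.sqrt (a₁ * b₂) * Real.sqrt (a₂ * b₁) := by
      rw [← Real.sqrt_mul (by positivity), ← Real.sqrt_mul (by positivity)]; congr 1; ring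
    rw [e]
    nlinarith [sq_nonneg (Real.sqrt (a₁ * b₂) - Real.sqrt (a₂ * b₁)), Real.sq_sqrt (by positivity : 0 ≤ a₁ * b₂),
      Real.sq_sqrt (by positivity : 0 ≤ a₂ * b₁)]
  nlinarith [h1, h2, h3]

/-- **U(C): THE TWO-SIDED COMPOSITION THEOREM at every level `C ≥ 28/27`** (`twoSided_comp_le` with `28/27 ↦ C`): valid pieces `x, y` (cells `≥ 0`,
sums `1`, `O_x, O_y > 0`) with Harris at `o, u, v` and `E ≤ C` compose to a piece with `E ≤ C`. [this work] -/
theorem twoSided_comp_le_C (C : ℝ) (hC : 28 / 27 ≤ C) (x0 B A m τ y0 B' A' m' τ' zB zA zm zτ : ℝ)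
    (h0 : 0 ≤ x0) (hB : 0 ≤ B) (hA : 0 ≤ A) (hm : 0 ≤ m) (hτ : 0 ≤ τ) (hsum : x0 + B + A + m + τ = 1)
    (h0' : 0 ≤ y0) (hB' : 0 ≤ B') (hA' : 0 ≤ A') (hm' : 0 ≤ m') (hτ' : 0 ≤ τ') (hsum' : y0 + B' + A' + m' + τ' = 1)
    (hOx : 0 < x0 + m) (hOy : 0 < y0 + m')
    (hH : (τ + B) * (τ + A) ≤ τ) (hHu : (τ + B) * (m + τ) ≤ τ) (hHv : (τ + A) * (m + τ) ≤ τ)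
    (hH' : (τ' + B') * (τ' + A') ≤ τ') (hHu' : (τ' + B') * (m' + τ') ≤ τ') (hHv' : (τ' + A') * (m' + τ') ≤ τ')
    (hE : (τ - (τ + B) * (τ + A)) ^ 2 ≤ C * ((τ + B) * (τ + A)) * m)
    (hE' : (τ' - (τ' + B') * (τ' + A')) ^ 2 ≤ C * ((τ' + B') * (τ' + A')) * m')
    (hzB : zB = x0 * B' + B * y0 + B * B') (hzA : zA = x0 * A' + A * y0 + A * A') (hzm : zm = x0 * m' + m * y0 + m * m')
    (hzτ : zτ = τ * (y0 + B' + A' + m' + τ') + (x0 + B + A + m) * τ' + B * (A' + m') + A * (B' + m') + m * (B' + A')) :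
    (zτ - (zτ + zB) * (zτ + zA)) ^ 2 ≤ C * ((zτ + zB) * (zτ + zA)) * zm := by
  -- square roots of O_x, O_y
  obtain ⟨sx, hsxd⟩ : ∃ t : ℝ, t = Real.sqrt (x0 + m) := ⟨_, rfl⟩
  obtain ⟨sy, hsyd⟩ : ∃ t : ℝ, t = Real.sqrt (y0 + m') := ⟨_, rfl⟩
  have hsx : 0 < sx := by rw [hsxd]; exact Real.sqrt_pos.2 hOx
  have hsy : 0 < sy := by rw [hsyd]; exact Real.sqrt_pos.2 hOy
  have hsx2 : sx ^ 2 = x0 + m := by rw [hsxd]; exact Real.sq_sqrt hOx.le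
  have hsy2 : sy ^ 2 = y0 + m' := by rw [hsyd]; exact Real.sq_sqrt hOy.le
  -- the conditional-shortcut port probabilities
  obtain ⟨p1, hp1⟩ : ∃ t : ℝ, t = (τ + B) + m' / (y0 + m') * A := ⟨_, rfl⟩
  obtain ⟨q1, hq1⟩ : ∃ t : ℝ, t = (τ + A) + m' / (y0 + m') * B := ⟨_, rfl⟩
  obtain ⟨p2, hp2⟩ : ∃ t : ℝ, t = (τ' + B') + m / (x0 + m) * A' := ⟨_, rfl⟩
  obtain ⟨q2, hq2⟩ : ∃ t : ℝ, t = (τ' + A') + m / (x0 + m) * B' := ⟨_, rfl⟩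
  have hp10 : 0 ≤ p1 := by rw [hp1]; positivity
  have hq10 : 0 ≤ q1 := by rw [hq1]; positivity
  have hp20 : 0 ≤ p2 := by rw [hp2]; positivity
  have hq20 : 0 ≤ q2 := by rw [hq2]; positivity
  have hpz := comp_p_ge x0 B A m τ y0 B' A' m' τ' sx sy zB zτ h0 hB hA hm hτ hsum h0' hB' hA' hm' hτ' hsum' hHv hHv' hsx hsx2 hsy hsy2 hzB hzτ
  have hπz := comp_pi_ge x0 B A m τ y0 B' A' m' τ' sx sy zA zτ h0 hB hA hm hτ hsum h0' hB' hA' hm' hτ' hsum' hHu hHu' hsx hsx2 hsy hsy2 hzA hzτ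
  rw [← hp1, ← hp2] at hpz
  rw [← hq1, ← hq2] at hπz
  -- Cauchy–Schwarz: p_z π_z ≥ (√(O_y P_{x′}) + √(O_x P_{y′}))²
  have hcs := cs_two_C (sy * p1) (sx * p2) (sy * q1) (sx * q2) (by positivity) (by positivity) (by positivity) (by positivity)
  have hprod : (sy * p1 + sx * p2) * (sy * q1 + sx * q2) ≤ (zτ + zB) * (zτ + zA) :=
    mul_le_mul hpz hπz (by positivity) (le_trans (by positivity) hpz)
  -- identify the two products
  have e1 : sy * p1 * (sy * q1) = (y0 + m') * (p1 * q1) := by rw [← hsy2]; ring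
  have e2 : sx * p2 * (sx * q2) = (x0 + m) * (p2 * q2) := by rw [← hsx2]; ring
  rw [e1, e2] at hcs
  -- Q_x ≤ O_x (Harris at o) :  P₂ = Q_x² P_{y′}/O_x ≤ O_x P_{y′}
  have hx0 : x0 = 1 - B - A - m - τ := by linarith
  have hQ : (x0 + m + A) * (x0 + m + B) ≤ x0 + m := by
    have e : (x0 + m) - (x0 + m + A) * (x0 + m + B) = τ - (τ + B) * (τ + A) := by rw [hx0]; ring
    linarith [e, sub_nonneg.2 hH]
  have hQ0 : 0 ≤ (x0 + m + A) * (x0 + m + B) := by positivity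
  have hP2le : ((x0 + m + A) * (x0 + m + B)) ^ 2 * (p2 * q2) / (x0 + m) ≤ (x0 + m) * (p2 * q2) := by
    rw [div_le_iff₀ hOx]
    have h1 : ((x0 + m + A) * (x0 + m + B)) ^ 2 ≤ (x0 + m) ^ 2 := pow_le_pow_left₀ hQ0 hQ 2
    have h2 : 0 ≤ p2 * q2 := by positivity
    calc ((x0 + m + A) * (x0 + m + B)) ^ 2 * (p2 * q2) ≤ (x0 + m) ^ 2 * (p2 * q2) := mul_le_mul_of_nonneg_right h1 h2
      _ = (x0 + m) * (p2 * q2) * (x0 + m) := by ring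
  have hsqrt2 : Real.sqrt (((x0 + m + A) * (x0 + m + B)) ^ 2 * (p2 * q2) / (x0 + m)) ≤ Real.sqrt ((x0 + m) * (p2 * q2)) :=
    Real.sqrt_le_sqrt hP2le
  have hb : (Real.sqrt ((y0 + m') * (p1 * q1)) + Real.sqrt (((x0 + m + A) * (x0 + m + B)) ^ 2 * (p2 * q2) / (x0 + m))) ^ 2
      ≤ (zτ + zB) * (zτ + zA) := by
    have hA1 : 0 ≤ Real.sqrt ((y0 + m') * (p1 * q1)) := Real.sqrt_nonneg _
    have hA2 : 0 ≤ Real.sqrt (((x0 + m + A) * (x0 + m + B)) ^ 2 * (p2 * q2) / (x0 + m)) := Real.sqrt_nonneg _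
    have hle : Real.sqrt ((y0 + m') * (p1 * q1)) + Real.sqrt (((x0 + m + A) * (x0 + m + B)) ^ 2 * (p2 * q2) / (x0 + m))
        ≤ Real.sqrt ((y0 + m') * (p1 * q1)) + Real.sqrt ((x0 + m) * (p2 * q2)) := by linarith [hsqrt2]
    calc (Real.sqrt ((y0 + m') * (p1 * q1)) + Real.sqrt (((x0 + m + A) * (x0 + m + B)) ^ 2 * (p2 * q2) / (x0 + m))) ^ 2
        ≤ (Real.sqrt ((y0 + m') * (p1 * q1)) + Real.sqrt ((x0 + m) * (p2 * q2))) ^ 2 :=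
          pow_le_pow_left₀ (by positivity) hle 2
      _ ≤ (sy * p1 + sx * p2) * (sy * q1 + sx * q2) := hcs
      _ ≤ (zτ + zB) * (zτ + zA) := hprod
  -- conclude with the transfer theorem of file IV
  exact twoSided_of_transfer_C C hC x0 B A m τ y0 B' A' m' τ' zB zA zm zτ ((y0 + m') * (p1 * q1))
    (((x0 + m + A) * (x0 + m + B)) ^ 2 * (p2 * q2) / (x0 + m))
    h0 hB hA hm hτ hsum h0' hB' hA' hm' hτ' hsum' hOx hOy hH hE hH' hE' hzB hzA hzm hzτ
    (by rw [hp1, hq1]) (by rw [hp2, hq2]) hb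

end APL

end Summit.CriticalPhenomena.PercolationContinuityZ3.Theorems
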